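import Literature.NumberTheory.EllipticCurves.IsogenyGroundFieldExtension
import Literature.NumberTheory.EllipticCurves.IsogenyVariableChangeProofs
import Literature.NumberTheory.EllipticCurves.IsogenyCompProofs
import Literature.NumberTheory.EllipticCurves.IsogenyBaseChange
import HarnessLib

/-!
# Transport of the `x`-coordinate formula of a `ℚ`-isogeny to changed models over a finite
# extension

`Proofs` file (theorems only: no definition, no named fact, no instance), topic
`NumberTheory/EllipticCurves`. Second of three files discharging the named fact
`Literature.NumberTheory.EllipticCurves.dokchitser_padicValInt_minimalDiscriminantInt_eq_of_isogeny_of_not_dvd_degree`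
(Dokchitser–Dokchitser 2015, Thm. 5.1 (1), clause `l ≠ p`).

* `WeierstrassCurve.VariableChange.toX_inv_map` — `(C⁻¹).toX x = u²x + r` (Silverman *AEC*
  III.1, Table 3.1).
* `WeierstrassCurve.exists_isogeny_of_smul_apply_some` — the substitution isomorphism
  `C • V → V` as an isogeny, with its action on affine points (the tree's
  `VariableChange.toIsogeny (C • V) C⁻¹` transported along `C⁻¹ • (C • V) = V`).
* `WeierstrassCurve.Isogeny.exists_x_formula_smul_extendScalars` — **if `x(φP) = A(x)/B(x)` off
  `ker φ` for a `ℚ`-isogeny `φ : W → W'` (`B` monic, `deg A = deg B + 1`, `lc A = k⁻²`), then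
  for every algebraic extension `F/ℚ` and changes of variables `C = (u, r, s, t)`,
  `C' = (u', r', s', t')` over `F`, the isogeny `Φ = ι_{C'} ∘ φ_F ∘ ι_C⁻¹ : C • W_F → C' • W'_F`
  (`φ_F` = `Isogeny.extendScalarsOfAlgEquiv`, Silverman *AEC* III.4: an isogeny over `ℚ` is
  defined over `F`) satisfies `x̃'(Φ P̃) = A♯(x̃)/B♯(x̃)` off its kernel with `A♯, B♯ ∈ F[X]`,
  `B♯` monic, `deg A♯ = deg B♯ + 1`, `lc A♯ = (k u'/u)⁻²`** — the substitution
  `x = u²x̃ + r`, `x̃' = u'⁻²(x' − r')`. This is the hypothesis shape of the tree's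
  `IsDedekindDomain.HeightOneSpectrum.valuation_multiplier_le_one` (`NeronIsogenyScalingHoldsProofs`)
  for the transported isogeny, whose multiplier is `k u'/u`.

References: [SilvermanAEC2009] III.1 Table 3.1, III.4 (p. 66, isogenies over extensions).
Declarations sit in Mathlib's `WeierstrassCurve` / `WeierstrassCurve.VariableChange` namespaces as
deliberate dot-notation extensions (the tree's `Isogeny`, `VariableChange.toX`).
-/

noncomputable section

open scoped Classical
open Polynomial

universe u v

namespace WeierstrassCurve

namespace VariableChange

variable {K : Type u} [Field K]

/-- `x`-coordinate of the inverse change of variables: `(C⁻¹).toX x = u² x + r` (Silverman,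
*AEC*, III.1: `x = u²x' + r`). [cite: SilvermanAEC2009, III.1 Table 3.1] -/
theorem toX_inv_map {L : Type v} [Field L] (f : K →+* L) (C : VariableChange K) (x : L) :
    (C⁻¹.map f).toX x = f (C.u : K) ^ 2 * x + f C.r := by
  rw [toX_def]
  simp only [VariableChange.inv_def, VariableChange.map, Units.coe_map, MonoidHom.coe_coe,
    Units.val_inv_eq_inv_val, map_mul, map_neg, map_pow, map_inv₀, inv_inv]
  have hu : f (C.u : K) ≠ 0 := (map_ne_zero f).mpr C.u.ne_zero
  field_simp
  ring

end VariableChange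

section Transport

variable {K : Type u} [Field K]

/-- The substitution isomorphism `C • V → V` of an admissible change of variables, as an
isogeny with its action on affine points: `(x, y) ↦ ((C⁻¹).toX x, (C⁻¹).toY x y)`
(the tree's `VariableChange.toIsogeny (C • V) C⁻¹` transported along `C⁻¹ • (C • V) = V`;
Silverman, *AEC*, III.3.1(b)). [cite: SilvermanAEC2009, III.1 Table 3.1] -/
theorem exists_isogeny_of_smul_apply_some (V : WeierstrassCurve K) (C : VariableChange K) :
    ∃ e : Isogeny (C • V) V, Function.Injective e ∧
      ∀ (x y : AlgebraicClosure K)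
        (h : ((C • V).baseChange (AlgebraicClosure K)).toAffine.Nonsingular x y),
        ∃ h', e (Affine.Point.some x y h) =
          Affine.Point.some ((C⁻¹.map (algebraMap K (AlgebraicClosure K))).toX x)
            ((C⁻¹.map (algebraMap K (AlgebraicClosure K))).toY x y) h' := by
  have h0 : ∃ e : Isogeny (C • V) (C⁻¹ • (C • V)), Function.Injective e ∧
      ∀ (x y : AlgebraicClosure K)
        (h : ((C • V).baseChange (AlgebraicClosure K)).toAffine.Nonsingular x y),
        ∃ h', e (Affine.Point.some x y h) =
          Affine.Point.some ((C⁻¹.map (algebraMap K (AlgebraicClosure K))).toX x)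
            ((C⁻¹.map (algebraMap K (AlgebraicClosure K))).toY x y) h' :=
    ⟨VariableChange.toIsogeny (C • V) C⁻¹, VariableChange.toIsogeny_injective _ _,
      fun x y h ↦ ⟨_, VariableChange.toIsogeny_some (C • V) C⁻¹ h⟩⟩
  rwa [inv_smul_smul] at h0

end Transport

section TransportRat

open Literature.NumberTheory.GaloisRepresentations

/-- **Transport of the `x`-formula of a `ℚ`-isogeny to models over a finite extension.** Let
`φ : W → W'` be a `ℚ`-isogeny of elliptic curves with `x(φ P) = A(x)/B(x)` off `ker φ`
(`A, B ∈ ℚ[X]`, `B` monic, `deg A = deg B + 1`, `lc A = k⁻²`), `F ⊇ ℚ` an algebraic extension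
and `C = (u, r, s, t)`, `C' = (u', r', s', t')` changes of variables over `F`. Then the isogeny
`Φ = ι_{C'} ∘ φ_F ∘ ι_C⁻¹ : C • W_F → C' • W'_F` has `x̃'(Φ P̃) = A♯(x̃)/B♯(x̃)` off its (finite)
kernel with `A♯, B♯ ∈ F[X]`, `B♯` monic, `deg A♯ = deg B♯ + 1` and `lc A♯ = (k u'/u)⁻²`
(substitute `x = u²x̃ + r`, `x̃' = u'⁻²(x' − r')`; Silverman, *AEC*, III.1 Table 3.1, III.4).
[cite: SilvermanAEC2009, III.1 Table 3.1] -/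
theorem Isogeny.exists_x_formula_smul_extendScalars {W W' : WeierstrassCurve ℚ} [W.IsElliptic]
    [W'.IsElliptic] (φ : Isogeny W W') {k : ℚ} {A B : ℚ[X]} (hBm : B.Monic)
    (hdeg : A.natDegree = B.natDegree + 1) (hlc : A.leadingCoeff = k⁻¹ ^ 2)
    (hform : ∀ (x y : AlgebraicClosure ℚ)
      (h : (W.baseChange (AlgebraicClosure ℚ)).toAffine.Nonsingular x y),
      φ (Affine.Point.some x y h) ≠ 0 →
      aeval x B ≠ 0 ∧ ∃ (y₂ : AlgebraicClosure ℚ)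
        (h₂ : (W'.baseChange (AlgebraicClosure ℚ)).toAffine.Nonsingular (aeval x A / aeval x B) y₂),
        φ (Affine.Point.some x y h) = Affine.Point.some (aeval x A / aeval x B) y₂ h₂)
    (F : Type) [Field F] [Algebra ℚ F] [Algebra.IsAlgebraic ℚ F] (C C' : VariableChange F) :
    ∃ (Φ : Isogeny (C • W.baseChange F) (C' • W'.baseChange F)) (A' B' : F[X])
      (Bad : Set (C • W.baseChange F).geomPoints),
      Bad.Finite ∧ B'.Monic ∧ A'.natDegree = B'.natDegree + 1 ∧
      A'.leadingCoeff = (algebraMap ℚ F k * (C'.u : F) * (C.u : F)⁻¹)⁻¹ ^ 2 ∧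
      ∀ (x y : AlgebraicClosure F)
        (h : ((C • W.baseChange F).baseChange (AlgebraicClosure F)).toAffine.Nonsingular x y),
        (Affine.Point.some x y h : (C • W.baseChange F).geomPoints) ∉ Bad →
        aeval x B' ≠ 0 ∧ ∃ (y₂ : AlgebraicClosure F)
          (h₂ : ((C' • W'.baseChange F).baseChange (AlgebraicClosure F)).toAffine.Nonsingular
            (aeval x A' / aeval x B') y₂),
          Φ (Affine.Point.some x y h) = Affine.Point.some (aeval x A' / aeval x B') y₂ h₂ := by
  classical
  haveI : (W.baseChange F).IsElliptic := inferInstanceAs (W.map (algebraMap ℚ F)).IsElliptic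
  haveI : (W'.baseChange F).IsElliptic := inferInstanceAs (W'.map (algebraMap ℚ F)).IsElliptic
  set ι : AlgebraicClosure ℚ ≃ₐ[ℚ] AlgebraicClosure F := absClosureEquiv ℚ F with hιdef
  set fF : F →+* AlgebraicClosure F := algebraMap F (AlgebraicClosure F) with hfF
  obtain ⟨e, -, he⟩ := exists_isogeny_of_smul_apply_some (W.baseChange F) C
  set Φ : Isogeny (C • W.baseChange F) (C' • W'.baseChange F) :=
    (VariableChange.toIsogeny (W'.baseChange F) C').comp ((φ.extendScalarsOfAlgEquiv ι).comp e)
    with hΦ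
  -- notation for the coefficients
  set u : F := (C.u : F) with hu
  set r : F := C.r with hr
  set u' : F := (C'.u : F) with hu'
  set r' : F := C'.r with hr'
  have hu0 : u ≠ 0 := C.u.ne_zero
  have hu'0 : u' ≠ 0 := C'.u.ne_zero
  set n : ℕ := B.natDegree with hn
  -- the polynomials over `F`
  set ℓ : F[X] := Polynomial.C (u ^ 2) * X + Polynomial.C r with hℓ
  have hℓdeg : ℓ.natDegree = 1 := by
    rw [hℓ]; exact natDegree_linear (pow_ne_zero 2 hu0)
  have hℓlc : ℓ.leadingCoeff = u ^ 2 := by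
    rw [hℓ]; exact leadingCoeff_linear (pow_ne_zero 2 hu0)
  have hℓ0 : ℓ.natDegree ≠ 0 := by rw [hℓdeg]; exact one_ne_zero
  set A₀ : F[X] := A.map (algebraMap ℚ F) with hA₀
  set B₀ : F[X] := B.map (algebraMap ℚ F) with hB₀
  have hB₀m : B₀.Monic := hBm.map _
  have hB₀deg : B₀.natDegree = n := by rw [hB₀, natDegree_map]
  have hA₀deg : A₀.natDegree = n + 1 := by rw [hA₀, natDegree_map, hdeg]
  have hA₀lc : A₀.leadingCoeff = (algebraMap ℚ F k)⁻¹ ^ 2 := by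
    rw [hA₀, leadingCoeff_map, hlc, map_pow, map_inv₀]
  set D : F[X] := A₀ - Polynomial.C r' * B₀ with hD
  have hDdeg : D.natDegree = n + 1 := by
    rw [hD, natDegree_sub_eq_left_of_natDegree_lt, hA₀deg]
    calc (Polynomial.C r' * B₀).natDegree ≤ B₀.natDegree := natDegree_C_mul_le _ _
      _ < A₀.natDegree := by rw [hB₀deg, hA₀deg]; exact Nat.lt_succ_self n
  have hDlc : D.leadingCoeff = (algebraMap ℚ F k)⁻¹ ^ 2 := by
    rw [hD, leadingCoeff_sub_of_degree_lt, hA₀lc]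
    apply Polynomial.degree_lt_degree
    calc (Polynomial.C r' * B₀).natDegree ≤ B₀.natDegree := natDegree_C_mul_le _ _
      _ < A₀.natDegree := by rw [hB₀deg, hA₀deg]; exact Nat.lt_succ_self n
  set B' : F[X] := Polynomial.C (u⁻¹ ^ (2 * n)) * B₀.comp ℓ with hB'
  set A' : F[X] := Polynomial.C (u'⁻¹ ^ 2 * u⁻¹ ^ (2 * n)) * D.comp ℓ with hA'
  have hB'deg : B'.natDegree = n := by
    rw [hB', natDegree_C_mul (pow_ne_zero _ (inv_ne_zero hu0)), natDegree_comp, hℓdeg, hB₀deg,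
      mul_one]
  have hB'm : B'.Monic := by
    rw [Monic, hB', leadingCoeff_mul, leadingCoeff_C, leadingCoeff_comp hℓ0, hB₀m.leadingCoeff,
      hℓlc, hB₀deg, one_mul, ← pow_mul, ← mul_pow, inv_mul_cancel₀ hu0, one_pow]
  have hA'deg : A'.natDegree = n + 1 := by
    rw [hA', natDegree_C_mul (mul_ne_zero (pow_ne_zero _ (inv_ne_zero hu'0))
      (pow_ne_zero _ (inv_ne_zero hu0))), natDegree_comp, hℓdeg, hDdeg, mul_one]
  have hA'lc : A'.leadingCoeff = (algebraMap ℚ F k * u' * u⁻¹)⁻¹ ^ 2 := by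
    rw [hA', leadingCoeff_mul, leadingCoeff_C, leadingCoeff_comp hℓ0, hDlc, hℓlc, hDdeg]
    have h1 : u⁻¹ ^ (2 * n) * (u ^ 2) ^ (n + 1) = u ^ 2 := by
      rw [pow_succ, ← pow_mul, ← mul_assoc, ← mul_pow, inv_mul_cancel₀ hu0, one_pow, one_mul]
    calc u'⁻¹ ^ 2 * u⁻¹ ^ (2 * n) * ((algebraMap ℚ F k)⁻¹ ^ 2 * (u ^ 2) ^ (n + 1))
        = u'⁻¹ ^ 2 * (algebraMap ℚ F k)⁻¹ ^ 2 * (u⁻¹ ^ (2 * n) * (u ^ 2) ^ (n + 1)) := by ring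
      _ = u'⁻¹ ^ 2 * (algebraMap ℚ F k)⁻¹ ^ 2 * u ^ 2 := by rw [h1]
      _ = (algebraMap ℚ F k * u' * u⁻¹)⁻¹ ^ 2 := by rw [mul_inv, mul_inv, inv_inv]; ring
  -- the exceptional set: the kernel of `Φ`
  refine ⟨Φ, A', B', (Φ.toAddMonoidHom.ker : Set (C • W.baseChange F).geomPoints),
    Φ.finite_ker, hB'm, by rw [hA'deg, hB'deg], hA'lc, fun x y h hBad ↦ ?_⟩
  -- Step 1: `e (x, y) = (X, Y)` with `X = u² x + r`
  obtain ⟨h₁, he₁⟩ := he x y h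
  set X : AlgebraicClosure F := (C⁻¹.map fF).toX x with hXdef
  set Y : AlgebraicClosure F := (C⁻¹.map fF).toY x y with hYdef
  have hX : X = fF u ^ 2 * x + fF r := VariableChange.toX_inv_map fF C x
  have hℓx : aeval x ℓ = X := by
    rw [hX, hℓ, map_add, map_mul, aeval_C, aeval_X, aeval_C, map_pow]
  set Q : (W.baseChange F).geomPoints := Affine.Point.some X Y h₁ with hQdef
  -- Step 2: `Q = ι_* P₀` with `P₀ = (ι⁻¹ X, ι⁻¹ Y) ∈ W(ℚ̄)`
  set P₀ : W.geomPoints := (W.geomPointsExtend F ι).symm Q with hP₀def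
  have hQ : W.geomPointsExtend F ι P₀ = Q := AddEquiv.apply_symm_apply _ _
  obtain ⟨h₀, hP₀⟩ : ∃ h₀, P₀ = Affine.Point.some (ι.symm X) (ι.symm Y) h₀ := by
    have : P₀ = W.geomPointsExtendInv F ι Q := rfl
    rw [this, geomPointsExtendInv, hQdef]
    exact ⟨_, Affine.Point.map_some (W' := W)
      (ι.symm : AlgebraicClosure F →ₐ[ℚ] AlgebraicClosure ℚ) h₁⟩
  have hφF : (φ.extendScalarsOfAlgEquiv ι) Q = W'.geomPointsExtend F ι (φ P₀) := by
    rw [← hQ, Isogeny.extendScalarsOfAlgEquiv_apply_geomPointsExtend]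
  -- Step 3: `φ P₀ ≠ 0`, so the `x`-formula applies at `P₀`
  have hφP₀ : φ P₀ ≠ 0 := by
    intro h0
    apply hBad
    change Φ (Affine.Point.some x y h) = 0
    rw [hΦ, Isogeny.comp_apply, Isogeny.comp_apply, he₁, hφF, h0, map_zero, map_zero]
  rw [hP₀] at hφP₀ hφF
  obtain ⟨hB0, y₂, h₂, hφeq⟩ := hform (ι.symm X) (ι.symm Y) h₀ hφP₀
  -- Step 4: `φ_F Q = ι_* (A(x₀)/B(x₀), y₂)`, `x₀ = ι⁻¹ X`
  have hgext : ∀ (a b : AlgebraicClosure ℚ)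
      (hab : (W'.baseChange (AlgebraicClosure ℚ)).toAffine.Nonsingular a b),
      ∃ hab', W'.geomPointsExtend F ι (Affine.Point.some a b hab) =
        Affine.Point.some (ι a) (ι b) hab' := fun a b hab ↦ by
    change ∃ hab', W'.geomPointsExtendHom F ι (Affine.Point.some a b hab) = _
    rw [geomPointsExtendHom]
    exact ⟨_, Affine.Point.map_some (W' := W')
      (ι : AlgebraicClosure ℚ →ₐ[ℚ] AlgebraicClosure F) hab⟩
  rw [hφeq] at hφF
  obtain ⟨h₃, hg⟩ := hgext _ _ h₂
  have hφF' : (φ.extendScalarsOfAlgEquiv ι) Q =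
      Affine.Point.some (ι (aeval (ι.symm X) A / aeval (ι.symm X) B)) (ι y₂) h₃ := hφF.trans hg
  -- Step 5: `Φ (x, y) = ι_{C'} (φ_F Q)`
  have hΦP : Φ (Affine.Point.some x y h) =
      VariableChange.toIsogeny (W'.baseChange F) C' ((φ.extendScalarsOfAlgEquiv ι) Q) := by
    rw [hΦ, Isogeny.comp_apply, Isogeny.comp_apply, he₁]
  rw [hφF', VariableChange.toIsogeny_some] at hΦP
  -- Step 6: the coordinates
  set a : AlgebraicClosure F := ι (aeval (ι.symm X) A) with hadef
  set b : AlgebraicClosure F := ι (aeval (ι.symm X) B) with hbdef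
  have hb0 : b ≠ 0 := by rw [hbdef]; exact (_root_.map_ne_zero ι).mpr hB0
  have haX : a = aeval X A₀ := by
    rw [hadef, ← Polynomial.aeval_algHom_apply, AlgEquiv.apply_symm_apply, hA₀,
      Polynomial.aeval_map_algebraMap]
  have hbX : b = aeval X B₀ := by
    rw [hbdef, ← Polynomial.aeval_algHom_apply, AlgEquiv.apply_symm_apply, hB₀,
      Polynomial.aeval_map_algebraMap]
  have hBx : aeval x B' = fF (u⁻¹ ^ (2 * n)) * b := by
    rw [hB', map_mul (aeval x), aeval_C, Polynomial.aeval_comp, hℓx, ← hbX]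
  have hAx : aeval x A' = fF (u'⁻¹ ^ 2 * u⁻¹ ^ (2 * n)) * (a - fF r' * b) := by
    rw [hA', map_mul (aeval x), aeval_C, Polynomial.aeval_comp, hℓx, hD, map_sub,
      map_mul (aeval X), aeval_C, ← haX, ← hbX]
  have hfu : fF u ≠ 0 := (_root_.map_ne_zero fF).mpr hu0
  have hfu' : fF u' ≠ 0 := (_root_.map_ne_zero fF).mpr hu'0
  have hBx0 : aeval x B' ≠ 0 := by
    rw [hBx]
    exact mul_ne_zero (by rw [map_pow, map_inv₀]; exact pow_ne_zero _ (inv_ne_zero hfu)) hb0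
  have hx' : (C'.map fF).toX (ι (aeval (ι.symm X) A / aeval (ι.symm X) B)) =
      aeval x A' / aeval x B' := by
    rw [VariableChange.toX_def, map_div₀, ← hadef, ← hbdef, hAx, hBx]
    simp only [VariableChange.map, Units.coe_map, MonoidHom.coe_coe, map_mul, map_pow, map_inv₀,
      Units.val_inv_eq_inv_val]
    rw [← hu', ← hr']
    field_simp
  refine ⟨hBx0, ?_⟩
  obtain ⟨h₄, hΦP'⟩ := Affine.Point.exists_eq_some_of_eq hΦP hx' rfl
  exact ⟨_, h₄, hΦP'⟩

end TransportRat

end WeierstrassCurve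

end
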